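import Summits.QuantumFields.BalabanUV.Beta.EriceFlowEnclosureB12AsPrintedPointwiseFadingOrderSharp
import Summits.QuantumFields.BalabanUV.Beta.EriceFlowEnclosureB12AsPrintedPointwiseFadingOrderSharpOscillation

/-!
# Beta / EriceFlowEnclosureB12AsPrintedPointwiseFadingOrderSharpWitness — WHAT (0.31) FORCES POINTWISE, part 7♯, THE CLAMP FAMILY: a history-dependent β
# INSIDE node U2's coupling-chart moduli along whose runs the discrepancy recursion of two same-length runs of (0.20) IS the adversarial comparison
# recursion of `…SharpOscillation` — every modulus inequality an equality, every feedback term with the order-killing sign.  The family (OURS, a toy, not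
# Bałaban's β): for constants C ≥ 0, 0 ≤ θ, 0 < τ,
#                         β_{k+1}(g_0, …, g_k) := C · Σ_{i≤k} θ^{k−i} · φ_τ(1 − g_i),        φ_τ(u) := max(−τ, min(τ, u))   (the clamp),
# i.e. each PAST coupling below the level 1 pushes 1∕g² DOWN (the coupling UP, towards 1) with geometrically fading weight Cθ^{age}, saturated at ±Cθ^{age}τ.
# LETTERS: `HistLipschitz Λ γ β` with Λ k i = Cθ^{k−i} EXACTLY, on every box (φ_τ is 1-Lipschitz) — so `FadingMemory C θ Λ` with equality (§1
# `histLipschitz_clamp`, `fadingMemory_clamp`); the constant history g ≡ 1 is an exact run of (0.20) of every length (β ≡ 0 along it, `rgEqH_const`).  THE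
# MECHANISM (§2): along any run a ⊂ ]0, ∞[ that stays in the band |1 − a_i| ≤ τ the clamp is inactive, φ_τ(1 − a_i) = 1 − a_i = w_i·D_i with D_i := 1∕a_i² − 1
# (the discrepancy against the constant run) and w_i = a_i²∕(1 + a_i) ∈ [(1−τ)²∕(2+τ), 2], so (0.20) reads EXACTLY
#                                   D_{k+1} = D_k − Σ_{i≤k} θ^{k−i}·(C w_i)·D_i                       (`band_recursion`)
# — the sum form of `…SharpOscillation` with coefficients c_i = Cw_i ≥ c₋ := C(1−τ)²∕(2+τ) —, hence the two-term inequality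
# D_{k+2} ≤ (1 + θ − c₋)D_{k+1} − θD_k on nonnegative stretches (`band_twoTerm`, via `twoTerm_at`), and |β_{k+1}| ≤ (2C∕(1−θ))·max_{i≤k}|D_i| (`beta_prefix_abs_le`,
# what keeps a run started near 1 inside the band for a prescribed number of steps).  The companion `…SharpWitnessEnd` chooses the constants: for every
# 0 < θ < 1 and every c > 2(1 − √θ)² a clamp family with Cγ³ ≤ c on the box ]0, γ], γ = 1 + τ, and a run started just below 1 that CROSSES the constant run
# within an explicit depth — ORDER REVERSAL inside the moduli above the edge, i.e. the constant 2(1 − √θ)² of `…Sharp.order_preserved_sqrt` cannot be raised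
# (β-flow team, prover 2 = lower ∕ positivity side, unit `b2b-balaban-beta-bflow-p2`, gen 45; ROW AP-I × node U2's letters; a TOY FAMILY of ours)

HONEST FRAMING (page 1 of everything the β sub-cell writes): discharging `BetaPertH` makes Bałaban's UV stability UNCONDITIONAL — a
real constructive-QFT result; it is NOT the continuum limit and NOT the Clay problem.  HONEST DEPENDENCY (cell reorg 2026-08-19,
verbatim): «continuum YM on T⁴ ⇐ BetaPertH ∧ nine spine estimates (0/9 proved); BetaPertH ⇐ (D1) ∧ (D4) ∧ CAP+tail; G-an2-4 gates
asym, D1 and NE2/3/4.»  THIS MODULE DISCHARGES NOTHING: it is elementary real analysis about an EXPLICIT TOY family of history-dependent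
functions (ours — NOT Bałaban's β of [I] = T. Bałaban, Commun. Math. Phys. **109** (1987) [Balaban1987RG1] (1.22) p. 264) and sequences obeying the
recursion (0.20) p. 256 for it; the moduli `HistLipschitz` ∕ `FadingMemory` it inhabits are node U2's UNPRINTED hypothesis shapes (GAPS G-t4-U2-2; p. 298 says
only that β_j "depends also on all preceding coupling constants").  The family is stated DEF-FREE: every theorem takes the letter
`hβ : ∀ k p, β k p = C · Σ_i θ^{k−i} φ_τ(1 − p_i)` as a hypothesis about an abstract `β : FlowStep.HBeta`.

WHAT THIS FILE PROVES (0 sorry, 0 def): §1 `clamp_lip`, `clamp_abs_le`, `clamp_eq`, `clamp_zero`, **`histLipschitz_clamp`**, **`fadingMemory_clamp`**, **`rgEqH_const`**;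
§2 `w_ident`, `coeff_lower`, `coeff_le_two`, `abs_one_sub_le_of_inv_sq`, **`beta_prefix_eq`**, **`beta_prefix_abs_le`**, **`band_recursion`**, **`band_twoTerm`**,
`start_facts`, `one_le_of_D_nonpos`.
NOT CLAIMED: anything about Bałaban's β; that Bałaban's β has (or lacks) fading memory; Theorem 2; `BetaPertH`; continuum; Clay.
-/

namespace Summit.QuantumFields.BalabanUV.Beta.EriceFlowEnclosureB12AsPrintedPointwiseFadingOrderSharpWitness

open Finset
open Literature.MathematicalPhysics.QuantumFieldTheory.Balaban1983to89
open Literature.MathematicalPhysics.QuantumFieldTheory.Balaban1983to89.FlowStep (HBeta prefixOf Box mem_box RGEqH)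
open Literature.MathematicalPhysics.QuantumFieldTheory.Balaban1983to89.T4CouplingMatching (HistLipschitz FadingMemory)
open Summit.QuantumFields.BalabanUV.Beta.EriceFlowEnclosureB12AsPrintedHistoryUniqueMono (geom_tail_le)
open Summit.QuantumFields.BalabanUV.Beta.EriceFlowEnclosureB12AsPrintedPointwiseFadingOrderSharpOscillation (twoTerm_at)

noncomputable section

variable {β : HBeta} {C θ τ : ℝ}

/-! ## §1 The clamp family inhabits the coupling-chart moduli with Λ k i = Cθ^{k−i} exactly -/

/-- The clamp φ_τ(u) = max(−τ, min(τ, u)) is 1-Lipschitz. [folklore] -/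
theorem clamp_lip (τ x y : ℝ) : |max (-τ) (min τ x) - max (-τ) (min τ y)| ≤ |x - y| := by
  calc |max (-τ) (min τ x) - max (-τ) (min τ y)|
      ≤ max |(-τ) - (-τ)| |min τ x - min τ y| := abs_max_sub_max_le_max _ _ _ _
    _ ≤ max |(-τ) - (-τ)| (max |τ - τ| |x - y|) := max_le_max le_rfl (abs_min_sub_min_le_max _ _ _ _)
    _ = |x - y| := by simp only [sub_self, abs_zero, max_eq_right (abs_nonneg (x - y))]

/-- |φ_τ(u)| ≤ τ (τ ≥ 0). [folklore] -/
theorem clamp_abs_le (hτ : 0 ≤ τ) (x : ℝ) : |max (-τ) (min τ x)| ≤ τ :=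
  abs_le.mpr ⟨le_max_left _ _, max_le (by linarith) (min_le_left _ _)⟩

/-- The clamp is inactive on [−τ, τ]: |u| ≤ τ ⟹ φ_τ(u) = u. [folklore] -/
theorem clamp_eq {x : ℝ} (h : |x| ≤ τ) : max (-τ) (min τ x) = x := by
  obtain ⟨h1, h2⟩ := abs_le.mp h
  rw [min_eq_right h2, max_eq_right h1]

/-- φ_τ(0) = 0 (τ ≥ 0). [folklore] -/
theorem clamp_zero (hτ : 0 ≤ τ) : max (-τ) (min τ (0 : ℝ)) = 0 :=
  clamp_eq (by rw [abs_zero]; exact hτ)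

/-- **THE CLAMP FAMILY CARRIES `HistLipschitz Λ γ β` WITH Λ k i = Cθ^{k−i}, ON EVERY BOX** (C ≥ 0, θ ≥ 0): |β_{k+1}(p) − β_{k+1}(q)| ≤ Σ_{i≤k} Cθ^{k−i}|p_i − q_i| because
φ_τ is 1-Lipschitz.  (Node U2's letter, [Balaban1987RG1] p. 298's history dependence made quantitative — here for a TOY family of ours.) [folklore] -/
theorem histLipschitz_clamp
    (hβ : ∀ (k : ℕ) (p : Fin (k + 1) → ℝ), β k p = C * ∑ i : Fin (k + 1), θ ^ (k - (i : ℕ)) * max (-τ) (min τ (1 - p i)))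
    (hC : 0 ≤ C) (hθ : 0 ≤ θ) (γ : ℝ) :
    HistLipschitz (fun k i => C * θ ^ (k - i)) γ β := by
  intro k p q _ _
  rw [hβ k p, hβ k q, ← mul_sub, ← Finset.sum_sub_distrib, abs_mul, abs_of_nonneg hC]
  have e : ∑ i : Fin (k + 1), C * θ ^ (k - (i : ℕ)) * |p i - q i|
      = C * ∑ i : Fin (k + 1), θ ^ (k - (i : ℕ)) * |p i - q i| := by
    rw [Finset.mul_sum]
    exact Finset.sum_congr rfl fun i _ => by ring
  rw [e]
  refine mul_le_mul_of_nonneg_left ?_ hC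
  refine (Finset.abs_sum_le_sum_abs _ _).trans (Finset.sum_le_sum fun i _ => ?_)
  rw [← mul_sub, abs_mul, abs_of_nonneg (pow_nonneg hθ _)]
  refine mul_le_mul_of_nonneg_left ?_ (pow_nonneg hθ _)
  have h := clamp_lip τ (1 - p i) (1 - q i)
  rwa [show (1 - p i) - (1 - q i) = q i - p i by ring, abs_sub_comm (q i) (p i)] at h

/-- **… WITH `FadingMemory C θ Λ` (equality)** (C ≥ 0, θ ≥ 0). [folklore] -/
theorem fadingMemory_clamp (hC : 0 ≤ C) (hθ : 0 ≤ θ) : FadingMemory C θ (fun k i => C * θ ^ (k - i)) :=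
  fun _ _ _ => ⟨mul_nonneg hC (pow_nonneg hθ _), le_rfl⟩

/-- **THE CONSTANT HISTORY g ≡ 1 IS A RUN OF (0.20) OF EVERY LENGTH**: β_{k+1}(1, …, 1) = C Σ θ^{k−i} φ_τ(0) = 0 (τ ≥ 0). [cite: Balaban1987RG1, (0.20) p.256 with p.298] -/
theorem rgEqH_const
    (hβ : ∀ (k : ℕ) (p : Fin (k + 1) → ℝ), β k p = C * ∑ i : Fin (k + 1), θ ^ (k - (i : ℕ)) * max (-τ) (min τ (1 - p i)))
    (hτ : 0 ≤ τ) (K : ℕ) : RGEqH K β (fun _ => 1) := by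
  intro k _
  rw [hβ]
  simp only [FlowStep.prefixOf_apply, sub_self, clamp_zero hτ, mul_zero, Finset.sum_const_zero, add_zero]

/-! ## §2 Inside the band |1 − a_i| ≤ τ the clamp is off and (0.20) is the adversarial comparison recursion -/

/-- The chart identity behind the coefficients: for a ≠ 0, a ≠ −1, `1 − a = (a²∕(1 + a))·(1∕a² − 1)`. [folklore] -/
theorem w_ident {a : ℝ} (ha : 0 < a) : 1 - a = a ^ 2 / (1 + a) * (1 / a ^ 2 - 1) := by
  have h1 : 1 + a ≠ 0 := by linarith
  field_simp
  ring

/-- **LOWER COEFFICIENT BOUND**: |1 − a| ≤ τ ≤ 1 ⟹ (1 − τ)²∕(2 + τ) ≤ a²∕(1 + a). [folklore] -/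
theorem coeff_lower {a : ℝ} (hτ1 : τ ≤ 1) (h : |1 - a| ≤ τ) :
    (1 - τ) ^ 2 / (2 + τ) ≤ a ^ 2 / (1 + a) := by
  obtain ⟨h1, h2⟩ := abs_le.mp h
  have hτ0 : 0 ≤ τ := (abs_nonneg _).trans h
  have hal : 1 - τ ≤ a := by linarith
  have hau : a ≤ 1 + τ := by linarith
  have hsq : (1 - τ) ^ 2 ≤ a ^ 2 := pow_le_pow_left₀ (by linarith) hal 2
  rw [div_le_div_iff₀ (by linarith) (by linarith)]
  nlinarith [mul_le_mul_of_nonneg_right hsq (by linarith : (0 : ℝ) ≤ 2 + τ),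
    mul_le_mul_of_nonneg_left (by linarith : 1 + a ≤ 2 + τ) (sq_nonneg (1 - τ))]

/-- **UPPER COEFFICIENT BOUND**: |1 − a| ≤ τ ≤ 1, a > 0 ⟹ a²∕(1 + a) ≤ 2. [folklore] -/
theorem coeff_le_two {a : ℝ} (ha : 0 < a) (hτ1 : τ ≤ 1) (h : |1 - a| ≤ τ) : a ^ 2 / (1 + a) ≤ 2 := by
  obtain ⟨_, h2⟩ := abs_le.mp h
  rw [div_le_iff₀ (by linarith)]
  nlinarith

/-- **FROM THE CHART TO THE COUPLING**: a > 0, |1∕a² − 1| ≤ η ≤ ½ ⟹ |1 − a| ≤ η (since (1−η)(1+η)² ≥ 1 and (1+η)(1−η)² ≤ 1 on [0, ½]). [folklore] -/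
theorem abs_one_sub_le_of_inv_sq {a η : ℝ} (ha : 0 < a) (hη1 : η ≤ 1 / 2) (h : |1 / a ^ 2 - 1| ≤ η) :
    |1 - a| ≤ η := by
  have hη0 : 0 ≤ η := (abs_nonneg _).trans h
  obtain ⟨hl, hu⟩ := abs_le.mp h
  rw [abs_le]
  constructor
  · -- a ≤ 1 + η: otherwise 1/a² < 1/(1+η)² ≤ 1 − η
    rcases le_or_gt a (1 + η) with h1 | h1
    · linarith
    · exfalso
      have hlt : 1 / a ^ 2 < 1 / (1 + η) ^ 2 :=
        one_div_lt_one_div_of_lt (by positivity) (pow_lt_pow_left₀ h1 (by linarith) two_ne_zero)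
      have hle : 1 / (1 + η) ^ 2 ≤ 1 - η := by
        rw [div_le_iff₀ (by positivity)]
        nlinarith [mul_nonneg hη0 (by nlinarith : (0 : ℝ) ≤ 1 - η - η ^ 2)]
      linarith
  · -- 1 − η ≤ a: otherwise 1/a² > 1/(1−η)² ≥ 1 + η
    rcases le_or_gt (1 - η) a with h1 | h1
    · linarith
    · exfalso
      have h1η : 0 < 1 - η := by linarith
      have hlt : 1 / (1 - η) ^ 2 < 1 / a ^ 2 :=
        one_div_lt_one_div_of_lt (by positivity) (pow_lt_pow_left₀ h1 ha.le two_ne_zero)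
      have hle : 1 + η ≤ 1 / (1 - η) ^ 2 := by
        rw [le_div_iff₀ (by positivity)]
        nlinarith [mul_nonneg hη0 (by nlinarith : (0 : ℝ) ≤ 1 + η - η ^ 2)]
      linarith

/-- **IN THE BAND THE CLAMP IS OFF — β ALONG THE PREFIX IS THE WEIGHTED DISCREPANCY SUM.**  For a positive sequence a with |1 − a_i| ≤ τ for i ≤ k:
`β_{k+1}(a_0, …, a_k) = Σ_{i≤k} θ^{k−i}·(C·a_i²∕(1+a_i))·(1∕a_i² − 1)`. [folklore] -/
theorem beta_prefix_eq
    (hβ : ∀ (k : ℕ) (p : Fin (k + 1) → ℝ), β k p = C * ∑ i : Fin (k + 1), θ ^ (k - (i : ℕ)) * max (-τ) (min τ (1 - p i)))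
    {a : ℕ → ℝ} {k : ℕ} (hpos : ∀ i, i ≤ k → 0 < a i) (hband : ∀ i, i ≤ k → |1 - a i| ≤ τ) :
    β k (prefixOf a k) = ∑ i ∈ range (k + 1), θ ^ (k - i) * (C * (a i ^ 2 / (1 + a i))) * (1 / a i ^ 2 - 1) := by
  rw [hβ, Finset.mul_sum,
    Finset.sum_range (fun i => θ ^ (k - i) * (C * (a i ^ 2 / (1 + a i))) * (1 / a i ^ 2 - 1))]
  refine Finset.sum_congr rfl fun i _ => ?_
  have hi : (i : ℕ) ≤ k := Nat.lt_succ_iff.mp i.isLt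
  simp only [FlowStep.prefixOf_apply]
  rw [clamp_eq (hband i hi), w_ident (hpos i hi)]
  ring

/-- **SIZE OF β IN THE BAND**: if moreover |1∕a_i² − 1| ≤ R for i ≤ k (and 0 ≤ θ < 1, 0 ≤ C, τ ≤ 1), then |β_{k+1}(a_0, …, a_k)| ≤ (2C∕(1 − θ))·R — the coefficients are
≤ 2C and the ages sum to ≤ 1∕(1 − θ).  What keeps a run started near 1 inside the band. [folklore] -/
theorem beta_prefix_abs_le
    (hβ : ∀ (k : ℕ) (p : Fin (k + 1) → ℝ), β k p = C * ∑ i : Fin (k + 1), θ ^ (k - (i : ℕ)) * max (-τ) (min τ (1 - p i)))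
    (hC : 0 ≤ C) (hθ0 : 0 ≤ θ) (hθ1 : θ < 1) (hτ1 : τ ≤ 1)
    {a : ℕ → ℝ} {k : ℕ} {R : ℝ} (hpos : ∀ i, i ≤ k → 0 < a i) (hband : ∀ i, i ≤ k → |1 - a i| ≤ τ)
    (hR : ∀ i, i ≤ k → |1 / a i ^ 2 - 1| ≤ R) :
    |β k (prefixOf a k)| ≤ 2 * C / (1 - θ) * R := by
  have hR0 : 0 ≤ R := (abs_nonneg _).trans (hR 0 (Nat.zero_le _))
  rw [beta_prefix_eq hβ hpos hband]
  have hterm : ∀ i ∈ range (k + 1),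
      |θ ^ (k - i) * (C * (a i ^ 2 / (1 + a i))) * (1 / a i ^ 2 - 1)| ≤ 2 * C * R * θ ^ (k - i) := by
    intro i hi
    have hik : i ≤ k := Nat.lt_succ_iff.mp (mem_range.mp hi)
    have ha := hpos i hik
    have hw0 : 0 ≤ a i ^ 2 / (1 + a i) := by positivity
    rw [abs_mul, abs_mul, abs_of_nonneg (pow_nonneg hθ0 _), abs_of_nonneg (mul_nonneg hC hw0)]
    have h1 : C * (a i ^ 2 / (1 + a i)) ≤ 2 * C := by
      have := coeff_le_two ha hτ1 (hband i hik); nlinarith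
    calc θ ^ (k - i) * (C * (a i ^ 2 / (1 + a i))) * |1 / a i ^ 2 - 1|
        ≤ θ ^ (k - i) * (2 * C) * R :=
          mul_le_mul (mul_le_mul_of_nonneg_left h1 (pow_nonneg hθ0 _)) (hR i hik) (abs_nonneg _) (by positivity)
      _ = 2 * C * R * θ ^ (k - i) := by ring
  calc |∑ i ∈ range (k + 1), θ ^ (k - i) * (C * (a i ^ 2 / (1 + a i))) * (1 / a i ^ 2 - 1)|
      ≤ ∑ i ∈ range (k + 1), |θ ^ (k - i) * (C * (a i ^ 2 / (1 + a i))) * (1 / a i ^ 2 - 1)| :=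
        Finset.abs_sum_le_sum_abs _ _
    _ ≤ ∑ i ∈ range (k + 1), 2 * C * R * θ ^ (k - i) := Finset.sum_le_sum hterm
    _ = 2 * C * R * ∑ i ∈ range (k + 1), θ ^ (k - i) := by rw [Finset.mul_sum]
    _ ≤ 2 * C * R * (1 / (1 - θ)) := by
        refine mul_le_mul_of_nonneg_left ?_ (by positivity)
        have h := geom_tail_le hθ0 hθ1 0 (k + 1)
        simp only [Nat.Ico_zero_eq_range, Nat.sub_zero] at h
        calc ∑ i ∈ range (k + 1), θ ^ (k - i) = ∑ i ∈ range (k + 1), θ ^ (k + 1 - 1 - i) :=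
              Finset.sum_congr rfl fun i _ => by rw [show k + 1 - 1 - i = k - i by omega]
          _ = ∑ i ∈ range (k + 1), θ ^ i := Finset.sum_range_reflect (fun i => θ ^ i) (k + 1)
          _ ≤ 1 / (1 - θ) := h
    _ = 2 * C / (1 - θ) * R := by ring

/-- **THE EXACT BAND RECURSION.**  A positive run a of (0.20) of length n for the clamp family, inside the band |1 − a_i| ≤ τ (i ≤ n), satisfies for k < n
`D_{k+1} = D_k − Σ_{i≤k} θ^{k−i}·(C·a_i²∕(1+a_i))·D_i`, D_i := 1∕a_i² − 1 — the SUM FORM of `…SharpOscillation` with coefficients c_i = C·a_i²∕(1+a_i): every modulus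
inequality of `…Sharp.signed_step_half` is an equality here, with the order-killing sign. [cite: Balaban1987RG1, (0.20) p.256 with p.298] -/
theorem band_recursion
    (hβ : ∀ (k : ℕ) (p : Fin (k + 1) → ℝ), β k p = C * ∑ i : Fin (k + 1), θ ^ (k - (i : ℕ)) * max (-τ) (min τ (1 - p i)))
    {n : ℕ} {a : ℕ → ℝ} (ha : RGEqH n β a) (hpos : ∀ i, i ≤ n → 0 < a i) (hband : ∀ i, i ≤ n → |1 - a i| ≤ τ)
    {k : ℕ} (hk : k < n) :
    1 / a (k + 1) ^ 2 - 1
      = (1 / a k ^ 2 - 1) - ∑ i ∈ range (k + 1), θ ^ (k - i) * (C * (a i ^ 2 / (1 + a i))) * (1 / a i ^ 2 - 1) := by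
  have e := ha k hk
  rw [beta_prefix_eq hβ (fun i hi => hpos i (hi.trans hk.le)) (fun i hi => hband i (hi.trans hk.le))] at e
  linarith

/-- **THE TWO-TERM INEQUALITY IN THE BAND.**  Same letters, τ ≤ 1, C ≥ 0, k + 2 ≤ n: if D_{k+1} ≥ 0 then
`D_{k+2} ≤ (1 + θ − c₋)·D_{k+1} − θ·D_k` with c₋ := C(1−τ)²∕(2+τ) (`twoTerm_at` on two consecutive band recursions, then `coeff_lower`). [cite: Balaban1987RG1, (0.20) p.256 with p.298] -/
theorem band_twoTerm
    (hβ : ∀ (k : ℕ) (p : Fin (k + 1) → ℝ), β k p = C * ∑ i : Fin (k + 1), θ ^ (k - (i : ℕ)) * max (-τ) (min τ (1 - p i)))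
    (hC : 0 ≤ C) (hτ1 : τ ≤ 1)
    {n : ℕ} {a : ℕ → ℝ} (ha : RGEqH n β a) (hpos : ∀ i, i ≤ n → 0 < a i) (hband : ∀ i, i ≤ n → |1 - a i| ≤ τ)
    {k : ℕ} (hk : k + 2 ≤ n) (hD : 0 ≤ 1 / a (k + 1) ^ 2 - 1) :
    1 / a (k + 2) ^ 2 - 1
      ≤ (1 + θ - C * ((1 - τ) ^ 2 / (2 + τ))) * (1 / a (k + 1) ^ 2 - 1) - θ * (1 / a k ^ 2 - 1) := by
  have h0 := band_recursion hβ ha hpos hband (k := k) (by omega)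
  have h1 := band_recursion hβ ha hpos hband (k := k + 1) (by omega)
  have ht := twoTerm_at (θ := θ) (c := fun i => C * (a i ^ 2 / (1 + a i))) (D := fun i => 1 / a i ^ 2 - 1) k h0 h1
  rw [ht]
  have hcl : C * ((1 - τ) ^ 2 / (2 + τ)) ≤ C * (a (k + 1) ^ 2 / (1 + a (k + 1))) :=
    mul_le_mul_of_nonneg_left (coeff_lower hτ1 (hband (k + 1) (by omega))) hC
  nlinarith [mul_le_mul_of_nonneg_right hcl hD]

/-- **THE START**: for δ₀ > 0 the coupling s := 1∕√(1 + δ₀) lies in ]0, 1[ and 1∕s² − 1 = δ₀. [folklore] -/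
theorem start_facts {δ₀ : ℝ} (hδ : 0 < δ₀) :
    0 < 1 / Real.sqrt (1 + δ₀) ∧ 1 / Real.sqrt (1 + δ₀) < 1 ∧ 1 / (1 / Real.sqrt (1 + δ₀)) ^ 2 - 1 = δ₀ := by
  have h1 : 1 < Real.sqrt (1 + δ₀) := by
    have h := Real.sqrt_lt_sqrt zero_le_one (by linarith : (1 : ℝ) < 1 + δ₀)
    rwa [Real.sqrt_one] at h
  have h0 : 0 < Real.sqrt (1 + δ₀) := by linarith
  refine ⟨by positivity, (div_lt_one h0).mpr h1, ?_⟩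
  rw [one_div_pow, one_div_one_div, Real.sq_sqrt (by linarith)]
  ring

/-- D_j ≤ 0 along a positive run means the coupling has reached the level 1: a > 0, 1∕a² − 1 ≤ 0 ⟹ 1 ≤ a. [folklore] -/
theorem one_le_of_D_nonpos {a : ℝ} (ha : 0 < a) (h : 1 / a ^ 2 - 1 ≤ 0) : 1 ≤ a := by
  by_contra hlt
  have hlt' : a < 1 := lt_of_not_ge hlt
  have : 1 < 1 / a ^ 2 := by
    rw [lt_div_iff₀ (by positivity)]; nlinarith
  linarith

end

end Summit.QuantumFields.BalabanUV.Beta.EriceFlowEnclosureB12AsPrintedPointwiseFadingOrderSharpWitness
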